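import Summits.ABC.IUTFork.Conditional.Layer5OfSV07
import Literature.IUT.HodgeTheaters.GlobalFrobenioidsCyclotomeIsoHalfGenuine
import Literature.IUT.HodgeTheaters.GlobalFrobenioidsCyclotomeIsoGenuineKummerInfKappaX
import Literature.IUT.HodgeTheaters.StableCurveTemperedDataOfSpecialFibreTowerComplete
import HarnessLib

/-!
# Layer-5 certificate, ADDITIVE PART v0.8 — [IUTchI] Ex 5.1 (v): E51/L27 in HALF-GENUINE form (brackets beside v0.7's genuine-container headline),
# NEW COVERAGE of the «respectively ∞κ×» cyclotome display at the genuine ∞κ× Kummer container, and the §2 (β) grounding with the `(INV)` law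
# discharged (director-abc (C2); plan/L5/LAYER5-CERT-SPEC.md §7; abc-iut-L5-lead gen 6 RULINGS #58 (2), #61 («(4H) once … lands»); writer abc-iut-L5-d1 gen 6)

cert L5 v0.8 additive part (one module, PROOF-ONLY: no `def`, no `instance`, no `axiom`, no `sorry`, no `notation`; every input BY NAME; nothing of
v0–v0.7 (p430789, p430066, p431142, p433973, p435437, p437623, p439054, p442476, p445926) is touched).  THREE theorems, then the top `layer5_of_S_v8`:

* (4H) `layer5_held_ex51v_v8_L27_halfGenuine` — E51/L27 (p.128 l.1–12) HALF-GENUINE (abc-iut-L5-d1 `NFBridgeRecon.uniqueCyclotomeIso_infκ_fieldLevel_of_etale_laws`,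
  `GlobalFrobenioidsCyclotomeIsoHalfGenuine` p445155, over abc-iut-f-190's genuine datum p443183): Frobenioid side + container GENUINE (the ∞κ Kummer
  container over the canonical open-normal levels, `κ(𝕄^⊛_∞κ)`, `H1ColimTwist`), étale side (`μ₁ H₁ im₁ induced` = [AbsTopIII] Thm 1.9 (d) outputs) an
  INTERFACE under TWO laws `h_Ex51v_19d` (E) and `h_Ex51v_CT` (T), plus conjunct 1's field-level binders.  Reported IN BRACKETS beside v0.7's headline
  `layer5_held_ex51v_v7_L27_genuine` (RULINGS #61: for L27 the genuine ∞κ container IS the printed étale-like side, so the symmetric form is the headline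
  «L27 0»; this item records «[2 with an independent étale interface]»).  NV of (E)(T): `NFBridgeRecon.etale_laws_infκ_fieldLevel_symmetric` (p445155).
* (5) `layer5_held_ex51v_v8_L27x_genuine` — NEW COVERAGE, E51/L27 «respectively ∞κ×» (the display for `μ_Ẑ(†𝕄^⊛_∞κ×)` / `𝕄^⊛_∞κ×(†𝒟^⊚) ⥲ †𝕄^⊛_∞κ×`, which
  had no conjunct in v0–v0.7) AT THE GENUINE ∞κ× KUMMER CONTAINER, symmetric form (abc-iut-f-190 `NFBridgeRecon.uniqueCyclotomeIso_infκx_fieldLevel`,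
  `GlobalFrobenioidsCyclotomeIsoGenuineKummerInfKappaX` p443477): binders = conjunct 2's v0.7 field-level list (`hroot hprim` side; `div ordmul polex zero`
  laws, the last through `minfκ_subset`) — 0 new laws, 0 new data; sub-DAG coverage +1.
* (6) `layer5_held_sec2_v8_prop24_piData_complete` — §2 (β′): v0.6's (β) `layer5_held_sec2_v6_prop24_piData` with the law `hINV` (`DetectsTempered`)
  DISCHARGED by abc-iut-f-193's `StableCurveTemperedData.OfSpecialFibre.prop24i_prop24ii_ofPiData_of_admKer_nhds_one`
  (`StableCurveTemperedDataOfSpecialFibreTowerComplete` p445247, over abc-iut-L5-t11 C4/C5 p444034/p444053 and abc-iut-w4-d063's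
  `hlimOn_of_admKer_nhds_one`): assertions (i) and (ii) now share `hadm`.  LAW 13 → 12 on the most-primitive §2 grounding (the (α) route, 9 laws with
  Prop 2.4 (i)/(ii) as opaque node binders, stays the most-reduced §2 count).

CENSUS v0.8 (BINDER CONVENTION of RULINGS #40 (1); HEADLINE RULE of RULINGS #61): most-reduced **CONE 34 (+2 record-laws in `P`) · FACT 0 · side 15 · NV 3 —
UNCHANGED headline** (E51: conj 1/2 field level 4 laws; L27 0 [2 half-genuine, this module]; L28 2 [0 sym]); COVERAGE +1 (E51/L27 ∞κ× display conjoined,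
0 new binders); alternative §2 grounding (β′) 12 primitive laws (v0.6 (β): 13).  Nodes 139 unchanged.  S-FREE.  Post-freeze-additive / proof-only modules
imported for the closers (not cone members): GlobalFrobenioidsCyclotomeIsoHalfGenuine (p445155), GlobalFrobenioidsCyclotomeIsoGenuineKummerInfKappaX (p443477),
StableCurveTemperedDataOfSpecialFibreTowerComplete (p445247) — all proof-only.

Mochizuki, *Inter-universal Teichmüller theory I: construction of Hodge theaters*, kurims manuscript (May 2020) [cite: Mochizuki2012]
(D-0012 claim key; series status DISPUTED); Mochizuki, *Semi-graphs of anabelioids*, Publ. RIMS 42 (2006) [cite: MochizukiSemiAnbd2006, Ex 3.10 pp.44-45].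
HONEST FRAMING: nothing in this file asserts that abc is proved or refuted or takes a side on [IUTchIII] Cor. 3.12 (nor on [IUTchI]); every binder is an
ASSUMPTION LABEL, not an endorsement; every conjunct is a CLOSED statement obtained by applying a LANDED closer BY NAME; in (5) the étale-like side is
SPECIALISED to the Frobenioid side along the [AbsTopIII] Thm 1.9 (d) identification (FACT-policy, never proved here), in (4H) it is MODELLED as interface
data; the record `P` of (6) is ORIGIN DATA (nothing asserts that a given curve admits it); typed ≠ inhabited ≠ discharged; indexed ≠ endorsed;
establishment = OUR kernel check only.  Later versions only REMOVE / SPLIT / RE-GROUND binders, SPECIALISE a free datum parameter to print's value, or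
ADD coverage under named binders.
-/

namespace Summit.ABC.IUTFork.Conditional

open CategoryTheory Literature.IUT.HodgeTheaters ProfiniteGrp ProfiniteGrp.ProfiniteCompletion NumberField IsDedekindDomain
open Literature.AnabelianGeometry.EtaleTheta Literature.AnabelianGeometry.EtaleTheta.ZHatLevel
open scoped Pointwise
universe u v

/-! ## E51/L27 — the ∞κ one-layer cyclotome display HALF-GENUINE: Frobenioid side + container = the genuine ∞κ Kummer container over the
canonical levels (abc-iut-f-190), étale side an interface under TWO laws (E) (T); the six v0.3 laws and the free data `C zμ twist ordC` GONE -/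

open scoped Classical in
/-- **Row 1116, node `IUTchI:Ex5.1(v)`, conjunct E51/L27 («there exists a unique isomorphism of cyclotomes `μ^Θ_Ẑ(π₁(†𝒟^⊚)) ⥲ μ_Ẑ(†𝕄^⊛_∞κ)`
such that the resulting isomorphism between direct limits of cohomology modules induces an isomorphism `𝕄^⊛_∞κ(†𝒟^⊚) ⥲ †𝕄^⊛_∞κ`», p.128 l.1–12)
RE-GROUNDED HALF-GENUINELY** (closer abc-iut-L5-d1 g6 `NFBridgeRecon.uniqueCyclotomeIso_infκ_fieldLevel_of_etale_laws`,
`GlobalFrobenioidsCyclotomeIsoHalfGenuine.lean` p445155, over abc-iut-f-190's genuine datum `uniqueCyclotomeIso_infκ_fieldLevel` p443183 and abc-iut-w4-d056's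
`cyclotome.zhatTwist_bijective` / field-level Kummer lane p436822).  Compared with the v0.2/v0.3 conjunct `UniqueCyclotomeIso C` over a FREE comparison
datum `C` with DATA `zμ`/`twist`/`Pt`/`ordC` and SIX law binders `h_Ex51v_zμ_one`/`_E`/`_T`/`_D`/`_Ctwo`/`_Cone`: the FROBENIOID SIDE AND THE CONTAINER
ARE NOW GENUINE — `μ_Ẑ(†𝕄^⊛_∞κ) = Λ(K_rat^×)`, the container `lim_{→ H} H¹(H, Λ(K_rat^×))` with `H` ranging over ALL OPEN NORMAL SUBGROUPS of
`π₁^rat(†𝒟^⊛)` (p.127), the subset = the genuine Kummer classes `κ(𝕄^⊛_∞κ)`, the container action `H1ColimTwist`, the `Ẑ^×`-torsor structure on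
isomorphisms of cyclotomes genuine (`Aut(Λ(K_rat^×)) = Ẑ^×`) — so `zμ_one`, the torsor half of (T), (D) divisor transport, `Ctwo`, `Cone` are
THEOREMS (the last three from conjunct 1's field-level binders through f-190's symmetric rigidity) and DISAPPEAR together with the free data.  The
ÉTALE-LIKE SIDE — `μ^Θ_Ẑ(π₁(†𝒟^⊚)) =: μ₁`, container `H₁`, `𝕄^⊛_∞κ(†𝒟^⊚) =: im₁`, the maps `induced e` ([AbsTopIII] Thm 1.9 (d), FACT-policy) —
stays interface DATA under exactly TWO law binders: `h_Ex51v_19d` = (E) «some isomorphism of cyclotomes induces `𝕄^⊛_∞κ(†𝒟^⊚) ⥲ †𝕄^⊛_∞κ`» (the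
Thm 1.9 (d) input) and `h_Ex51v_CT` = (T) functoriality of the étale-side realisation under the `Ẑ^×`-twist; the remaining hypotheses are CONJUNCT 1's
v0.5 field-level binders BY NAME (`hroot hprim` side; `h_Ex51v_div` · `h_Ex51v_ordmul` · `h_Ex51v_polex` restricted along `NFBridgeRecon.minfκ_subset` ·
`h_Ex51v_zero`).  LAW binders 2 new (v0.3: 6) + 4 shared with conjunct 1; DATA `μ₁ H₁ im₁ induced`; side `hroot hprim` (shared); FACT 0.  Reported IN BRACKETS beside
the headline `layer5_held_ex51v_v7_L27_genuine` (RULINGS #61: for E51/L27 the genuine ∞κ container is the printed étale-like side).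
Nothing here asserts that abc is proved or refuted or takes a side on [IUTchIII] Cor. 3.12; a binder is an assumption label; typed ≠ discharged. -/
theorem layer5_held_ex51v_v8_L27_halfGenuine (N : NFBridgeRecon.{0})
    -- DATUM side-conditions of the genuine `K_rat = L̄_C` (as v0.5 conjunct 1)
    (hroot : ∀ a : N.Krat, a ≠ 0 → ∀ n : ℕ, 0 < n → ∃ b : N.Krat, b ^ n = a)
    (hprim : ∀ n : ℕ, 0 < n → ∃ ζ : N.Krat, IsPrimitiveRoot ζ n)
    -- LAW E51/L26 at field level (as v0.5 conjunct 1)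
    (h_Ex51v_div : ∀ (H : OpenNormalSubgroup N.piRat) (a : N.Krat), a ≠ 0 → (∀ h : N.piRat, h ∈ H → h • a = a) →
      (∀ n : ℕ+, ∃ b : N.Krat, (∀ h : N.piRat, h ∈ H → h • b = b) ∧ b ^ (n : ℕ) = a) → a = 1)
    -- DATA: orders at points; LAW (o) (as v0.5 conjunct 1)
    {X : Type v} (ord : X → N.Krat → ℤ)
    (h_Ex51v_ordmul : ∀ (x : X) (a b : N.Krat), a ≠ 0 → b ≠ 0 → (∀ g : N.piRat, g • a = a) → (∀ g : N.piRat, g • b = b) →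
      ord x (a * b) = ord x a + ord x b)
    -- LAW Rmk 3.1.7 (i)/(ii) (as v0.2/v0.3/v0.5)
    (h_Ex51v_polex : ∀ f' ∈ N.Minfκx, (∀ g : N.piRat, g • f' = f') →
      ∀ x₁ x₂ : X, x₁ ≠ x₂ → ¬ (ord x₁ f' < 0 ∧ ord x₂ f' < 0))
    (h_Ex51v_zero : ∃ f ∈ N.Minfκ, (∀ g : N.piRat, g • f = f) ∧
      ∃ x₁ x₂ : X, x₁ ≠ x₂ ∧ 0 < ord x₁ f ∧ 0 < ord x₂ f)
    -- DATA (étale-like side = [AbsTopIII] Thm 1.9 outputs, an interface): cyclotome, container, the ∞κ-coric sub-object, induced maps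
    (μ₁ : Type) [CommGroup μ₁] (H₁ : Type) (im₁ : Set H₁)
    (induced : (μ₁ ≃* cyclotome N.Kratˣ) → H₁ →
      letI : MulDistribMulAction N.piRat N.Kratˣ := Units.mulDistribMulActionRight
      H1Colimit N.Kratˣ
        (fun i : (OpenNormalSubgroup N.piRat)ᵒᵈ => ((OrderDual.ofDual i : OpenNormalSubgroup N.piRat) : Subgroup N.piRat))
        N.openNormal_antitone)
    -- LAW (E) = [AbsTopIII] Thm 1.9 (d): some isomorphism of cyclotomes induces `𝕄^⊛_∞κ(†𝒟^⊚) ⥲ †𝕄^⊛_∞κ`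
    (h_Ex51v_19d : ∃ e₀ : μ₁ ≃* cyclotome N.Kratˣ,
      letI : MulDistribMulAction N.piRat N.Kratˣ := Units.mulDistribMulActionRight
      letI : RootableBy N.Kratˣ ℕ := rootableByOfPowLeftSurj N.Kratˣ ℕ fun hn => N.units_pow_surjective_of_roots hroot hn
      haveI : Nonempty (OpenNormalSubgroup N.piRat)ᵒᵈ :=
        ⟨OrderDual.toDual { toOpenSubgroup := ⊤, isNormal' := Subgroup.normal_of_characteristic ⊤ }⟩
      Set.BijOn (induced e₀) im₁ (Set.range fun f : N.infκPair.carrier =>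
        kummerMap N.openNormal_antitone (N.isExhausted_openNormal fun _ _ => rfl)
          (Units.mk0 (f : N.Krat) (N.coe_infκPair_ne_zero f))))
    -- LAW (T): functoriality of the étale-side realisation under the `Ẑ^×`-twist of the coefficients
    (h_Ex51v_CT : ∀ (e : μ₁ ≃* cyclotome N.Kratˣ) (u : MulAut (completion (GrpCat.of (Multiplicative ℤ)))) (h : H₁),
      letI : MulDistribMulAction N.piRat N.Kratˣ := Units.mulDistribMulActionRight
      induced (e.trans (cyclotome.zhatTwist N.Kratˣ u)) h =
        H1ColimTwist
          (fun i : (OpenNormalSubgroup N.piRat)ᵒᵈ => ((OrderDual.ofDual i : OpenNormalSubgroup N.piRat) : Subgroup N.piRat))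
          N.openNormal_antitone u (induced e h)) :
    letI : MulDistribMulAction N.piRat N.Kratˣ := Units.mulDistribMulActionRight
    letI : RootableBy N.Kratˣ ℕ := rootableByOfPowLeftSurj N.Kratˣ ℕ fun hn => N.units_pow_surjective_of_roots hroot hn
    haveI : Nonempty (OpenNormalSubgroup N.piRat)ᵒᵈ :=
      ⟨OrderDual.toDual { toOpenSubgroup := ⊤, isNormal' := Subgroup.normal_of_characteristic ⊤ }⟩
    UniqueCyclotomeIso                                                    -- E51/L27, half-genuine, canonical levels
      { μ₁ := μ₁
        μ₂ := cyclotome N.Kratˣ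
        H₁ := H₁
        H₂ := H1Colimit N.Kratˣ
          (fun i : (OpenNormalSubgroup N.piRat)ᵒᵈ => ((OrderDual.ofDual i : OpenNormalSubgroup N.piRat) : Subgroup N.piRat))
          N.openNormal_antitone
        im₁ := im₁
        im₂ := Set.range fun f : N.infκPair.carrier =>
          kummerMap N.openNormal_antitone (N.isExhausted_openNormal fun _ _ => rfl)
            (Units.mk0 (f : N.Krat) (N.coe_infκPair_ne_zero f))
        induced := induced } :=
  N.uniqueCyclotomeIso_infκ_fieldLevel_of_etale_laws (fun hn => N.units_pow_surjective_of_roots hroot hn) hprim h_Ex51v_div ord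
    h_Ex51v_ordmul (fun f' hf' hfix => h_Ex51v_polex f' (N.minfκ_subset hf') hfix) h_Ex51v_zero μ₁ H₁ im₁ induced h_Ex51v_19d
    h_Ex51v_CT

/-! ## E51/L27, «respectively ∞κ×» — NEW COVERAGE: the one-layer cyclotome display for `†𝕄^⊛_∞κ×` AT THE GENUINE ∞κ× KUMMER CONTAINER (abc-iut-f-190),
symmetric form; binders = conjunct 2's field-level list, nothing new -/

open scoped Classical in
/-- **Row 1116, node `IUTchI:Ex5.1(v)`, conjunct E51/L27 «respectively» (∞κ×: «there exists a unique isomorphism of cyclotomes `μ^Θ_Ẑ(π₁(†𝒟^⊚)) ⥲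
μ_Ẑ(†𝕄^⊛_∞κ×)` such that the resulting isomorphism … induces an isomorphism `𝕄^⊛_∞κ×(†𝒟^⊚) ⥲ †𝕄^⊛_∞κ×`», p.128 l.1–12) — NEW COVERAGE AT THE GENUINE ∞κ×
KUMMER CONTAINER, symmetric form** (closer abc-iut-f-190 g5's `NFBridgeRecon.uniqueCyclotomeIso_infκx_fieldLevel`,
`GlobalFrobenioidsCyclotomeIsoGenuineKummerInfKappaX.lean` p443477; the ∞κ× twin of v0.7's `layer5_held_ex51v_v7_L27_genuine`).  The v0.2/v0.3 block
carried ONE cyclotome-comparison conjunct (the ∞κ display, over a free datum `C`); the printed «respectively, ∞κ×» display had no conjunct.  Here it is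
conjoined at the genuine datum of the Ex 5.1 (i) data `N`: both cyclotomes `Λ(K_rat^×)`, both containers the genuine `lim_{→ H} H¹(H, Λ(K_rat^×))` over ALL
open normal subgroups `H` of `π₁^rat(†𝒟^⊛)`, both subsets the genuine Kummer classes `κ(𝕄^⊛_∞κ×)`, induced map = the container twist by the cyclotomic
character (the étale side SPECIALISED to the Frobenioid side along the [AbsTopIII] Thm 1.9 (d) identification — FACT-policy, as in the ∞κ item; RULINGS #61
headline rule: the ∞κ× Kummer container is the printed container).  Hypotheses = CONJUNCT 2's v0.7 field-level binders BY NAME and nothing else: side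
`hroot hprim`, laws `h_Ex51v_div` · `h_Ex51v_ordmul` · `h_Ex51v_polex` · `h_Ex51v_zero` (a fixed ∞κ-coric function with two zeroes is ∞κ×-coric,
`NFBridgeRecon.minfκ_subset`).  LAW binders 0 new; DATA 0 new; sub-DAG coverage E51/L27 (∞κ×) +1.  Nothing here asserts that abc is proved or refuted or
takes a side on [IUTchIII] Cor. 3.12; a binder is an assumption label; typed ≠ inhabited ≠ discharged. -/
theorem layer5_held_ex51v_v8_L27x_genuine (N : NFBridgeRecon.{0})
    -- DATUM side-conditions of the genuine `K_rat = L̄_C` (as v0.5/v0.7)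
    (hroot : ∀ a : N.Krat, a ≠ 0 → ∀ n : ℕ, 0 < n → ∃ b : N.Krat, b ^ n = a)
    (hprim : ∀ n : ℕ, 0 < n → ∃ ζ : N.Krat, IsPrimitiveRoot ζ n)
    -- LAW E51/L26 at field level (as v0.5/v0.7)
    (h_Ex51v_div : ∀ (H : OpenNormalSubgroup N.piRat) (a : N.Krat), a ≠ 0 → (∀ h : N.piRat, h ∈ H → h • a = a) →
      (∀ n : ℕ+, ∃ b : N.Krat, (∀ h : N.piRat, h ∈ H → h • b = b) ∧ b ^ (n : ℕ) = a) → a = 1)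
    -- DATA: orders at points; LAW (o) (as v0.5/v0.7)
    {X : Type v} (ord : X → N.Krat → ℤ)
    (h_Ex51v_ordmul : ∀ (x : X) (a b : N.Krat), a ≠ 0 → b ≠ 0 → (∀ g : N.piRat, g • a = a) → (∀ g : N.piRat, g • b = b) →
      ord x (a * b) = ord x a + ord x b)
    -- LAW Rmk 3.1.7 (i)/(ii) (as v0.2/v0.3/v0.5/v0.7)
    (h_Ex51v_polex : ∀ f' ∈ N.Minfκx, (∀ g : N.piRat, g • f' = f') →
      ∀ x₁ x₂ : X, x₁ ≠ x₂ → ¬ (ord x₁ f' < 0 ∧ ord x₂ f' < 0))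
    (h_Ex51v_zero : ∃ f ∈ N.Minfκ, (∀ g : N.piRat, g • f = f) ∧
      ∃ x₁ x₂ : X, x₁ ≠ x₂ ∧ 0 < ord x₁ f ∧ 0 < ord x₂ f) :
    letI : MulDistribMulAction N.piRat N.Kratˣ := Units.mulDistribMulActionRight
    letI : RootableBy N.Kratˣ ℕ := rootableByOfPowLeftSurj N.Kratˣ ℕ fun hn => N.units_pow_surjective_of_roots hroot hn
    haveI : Nonempty (OpenNormalSubgroup N.piRat)ᵒᵈ :=
      ⟨OrderDual.toDual { toOpenSubgroup := ⊤, isNormal' := Subgroup.normal_of_characteristic ⊤ }⟩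
    UniqueCyclotomeIso                                                    -- E51/L27 «resp. ∞κ×» at the genuine ∞κ× container
      { μ₁ := cyclotome N.Kratˣ
        μ₂ := cyclotome N.Kratˣ
        H₁ := H1Colimit N.Kratˣ
          (fun i : (OpenNormalSubgroup N.piRat)ᵒᵈ => ((OrderDual.ofDual i : OpenNormalSubgroup N.piRat) : Subgroup N.piRat))
          N.openNormal_antitone
        H₂ := H1Colimit N.Kratˣ
          (fun i : (OpenNormalSubgroup N.piRat)ᵒᵈ => ((OrderDual.ofDual i : OpenNormalSubgroup N.piRat) : Subgroup N.piRat))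
          N.openNormal_antitone
        im₁ := Set.range fun f : N.infκxPair.carrier =>
          kummerMap N.openNormal_antitone (N.isExhausted_openNormal fun _ _ => rfl)
            (Units.mk0 (f : N.Krat) (N.coe_ne_zero_of_subset N.Minfκx _ N.zero_notMem f))
        im₂ := Set.range fun f : N.infκxPair.carrier =>
          kummerMap N.openNormal_antitone (N.isExhausted_openNormal fun _ _ => rfl)
            (Units.mk0 (f : N.Krat) (N.coe_ne_zero_of_subset N.Minfκx _ N.zero_notMem f))
        induced := fun e => H1ColimTwist
          (fun i : (OpenNormalSubgroup N.piRat)ᵒᵈ => ((OrderDual.ofDual i : OpenNormalSubgroup N.piRat) : Subgroup N.piRat))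
          N.openNormal_antitone
          ((Equiv.ofBijective _ (cyclotome.zhatTwist_bijective (R := N.Krat) hprim)).symm e) } :=
  N.uniqueCyclotomeIso_infκx_fieldLevel (fun hn => N.units_pow_surjective_of_roots hroot hn) hprim h_Ex51v_div ord h_Ex51v_ordmul
    h_Ex51v_polex (h_Ex51v_zero.imp fun _ hf => ⟨N.minfκ_subset hf.1, hf.2⟩)

section Sec2V8

open Topology Literature.AnabelianGeometry.SemiGraphs Literature.AnabelianGeometry.SemiGraphs.ProfiniteSemiGraph

/-! ## §2 (β′): v0.6's (β) with the `(INV)` law DISCHARGED — tempered detection from the admissible kernels alone (abc-iut-f-193) -/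

/-- **v0.8 (β′): v0.6's `layer5_held_sec2_v6_prop24_piData` ((β), the most-primitive §2 grounding: Prop 2.4 (i)/(ii) unfolded to their printed
per-level inputs over L3's origin-data record `P : SpecialFibreTower.PiData`) with the law `hINV` («`DetectsTempered`»: the tower detects temperedness,
[SemiAnbd] §3 / [André]) DISCHARGED** — abc-iut-f-193's `StableCurveTemperedData.OfSpecialFibre.prop24i_prop24ii_ofPiData_of_admKer_nhds_one`
(`StableCurveTemperedDataOfSpecialFibreTowerComplete.lean` p445247, audited SOUND by abc-iut-w4-d080 12:34:16Z; engines abc-iut-L5-t11 C4/C5 p444034/p444053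
`detectsTempered_of_inverseLimit` pattern + abc-iut-w4-d063 `hlimOn_of_admKer_nhds_one`): temperedness detection follows from the admissible kernels
shrinking to `1` (`hadm`, already a binder of (β) for Prop 2.4 (ii)) — assertions (i) and (ii) now SHARE `hadm`.  LAW binders h22 · hHstab · hA · hB · hv ·
htp · hhat · hstf · hA3 · hspec · hadm · hLev = 12 (v0.6 (β): 13), none an [IUTchI] node statement; data T, P, Λv, E, src, tgt, c₁, c₂; side hΛv.
The (α) route (9 laws, Prop 2.4 (i)/(ii) as opaque node binders) stays the most-reduced §2 count; (β′) is the most-primitive grounding.  Nothing here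
asserts that abc is proved or refuted or takes a side on [IUTchIII] Cor. 3.12; a binder is an assumption label; typed ≠ discharged. -/
theorem layer5_held_sec2_v8_prop24_piData_complete
    {p : ℕ} [Fact p.Prime] (X : Literature.AnabelianGeometry.SemiGraphs.TemperedCurve p) (d : X.GroupLevelData)
    (S : Literature.AnabelianGeometry.SemiGraphs.SpecialFibreData (X.toTemperedArithmeticGroup d)) (h36 : S.Gc.Prop36Hypotheses)
    (Sigma SigmaHat : Set ℕ) (hsub : Sigma ⊆ SigmaHat) (hne : Sigma.Nonempty)
    (hprime : ∀ q ∈ SigmaHat, q.Prime) (hp : p ∉ Sigma) (TpH : Subgroup S.chart.G)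
    (cuspMeetsH : {x : X.Pt // X.IsCusp x} → Prop) (x : {x : X.Pt // X.IsCusp x})
    (T : SpecialFibreTower X.DeltaTemp) (P : SpecialFibreTower.PiData X d S T)
    (h22 : (StableCurveTemperedData.ofSpecialFibre X d S h36 Sigma SigmaHat hsub hne hprime hp TpH ((TpH.map (TemperedGraphGroupData.exists_completion_of_prop36 S.Gc h36 S.chart).choose_spec.choose.toMonoidHom).topologicalClosure) (Subgroup.le_topologicalClosure _) cuspMeetsH).graph.CommensuratorsOfDecompositionSubgroups)
    (hHstab : ∀ g : X.PiTemp, ∃ t : S.chart.G,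
      TpH.map (S.autOfConj P.admissibleKer_normal_pi g).toMulEquiv.toMonoidHom = MulAut.conj t • TpH)
    (hA : (∃ l ∈ SigmaHat, l ∉ Sigma ∧ l ≠ p) →
      ∀ (i : ℕ) (a : (StableCurveTemperedData.ofSpecialFibre X d S h36 Sigma SigmaHat hsub hne hprime hp TpH ((TpH.map (TemperedGraphGroupData.exists_completion_of_prop36 S.Gc h36 S.chart).choose_spec.choose.toMonoidHom).topologicalClosure) (Subgroup.le_topologicalClosure _) cuspMeetsH).DeltaHat),
        (∀ y ∈ ((StableCurveTemperedData.OfSpecialFibre.towerOfSpecialFibreTower X d T Sigma SigmaHat hsub hne hprime S h36 hp TpH ((TpH.map (TemperedGraphGroupData.exists_completion_of_prop36 S.Gc h36 S.chart).choose_spec.choose.toMonoidHom).topologicalClosure) (Subgroup.le_topologicalClosure _) cuspMeetsH).Jhat i).subgroupOf (StableCurveTemperedData.ofSpecialFibre X d S h36 Sigma SigmaHat hsub hne hprime hp TpH ((TpH.map (TemperedGraphGroupData.exists_completion_of_prop36 S.Gc h36 S.chart).choose_spec.choose.toMonoidHom).topologicalClosure) (Subgroup.le_topologicalClosure _) cuspMeetsH).DeltaHat,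 y ∈ (StableCurveTemperedData.ofSpecialFibre X d S h36 Sigma SigmaHat hsub hne hprime hp TpH ((TpH.map (TemperedGraphGroupData.exists_completion_of_prop36 S.Gc h36 S.chart).choose_spec.choose.toMonoidHom).topologicalClosure) (Subgroup.le_topologicalClosure _) cuspMeetsH).ρHat.ker → a * y = y * a) →
        a ∈ ((StableCurveTemperedData.OfSpecialFibre.towerOfSpecialFibreTower X d T Sigma SigmaHat hsub hne hprime S h36 hp TpH ((TpH.map (TemperedGraphGroupData.exists_completion_of_prop36 S.Gc h36 S.chart).choose_spec.choose.toMonoidHom).topologicalClosure) (Subgroup.le_topologicalClosure _) cuspMeetsH).Jhat i).subgroupOf (StableCurveTemperedData.ofSpecialFibre X d S h36 Sigma SigmaHat hsub hne hprime hp TpH ((TpH.map (TemperedGraphGroupData.exists_completion_of_prop36 S.Gc h36 S.chart).choose_spec.choose.toMonoidHom).topologicalClosure) (Subgroup.le_topologicalClosure _) cuspMeetsH).DeltaHat)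
    (hB : SigmaHat = {q | q.Prime} →
      ∀ (i : ℕ) (a : (StableCurveTemperedData.ofSpecialFibre X d S h36 Sigma SigmaHat hsub hne hprime hp TpH ((TpH.map (TemperedGraphGroupData.exists_completion_of_prop36 S.Gc h36 S.chart).choose_spec.choose.toMonoidHom).topologicalClosure) (Subgroup.le_topologicalClosure _) cuspMeetsH).DeltaHat),
        (∀ y ∈ ((StableCurveTemperedData.OfSpecialFibre.towerOfSpecialFibreTower X d T Sigma SigmaHat hsub hne hprime S h36 hp TpH ((TpH.map (TemperedGraphGroupData.exists_completion_of_prop36 S.Gc h36 S.chart).choose_spec.choose.toMonoidHom).topologicalClosure) (Subgroup.le_topologicalClosure _) cuspMeetsH).Jhat i).subgroupOf (StableCurveTemperedData.ofSpecialFibre X d S h36 Sigma SigmaHat hsub hne hprime hp TpH ((TpH.map (TemperedGraphGroupData.exists_completion_of_prop36 S.Gc h36 S.chart).choose_spec.choose.toMonoidHom).topologicalClosure) (Subgroup.le_topologicalClosure _) cuspMeetsH).DeltaHat, y ∈ (StableCurveTemperedData.ofSpecialFibre X d S h36 Sigma SigmaHat hsub hne hprime hp TpH ((TpH.map (TemperedGraphGroupData.exists_completion_of_prop36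 S.Gc h36 S.chart).choose_spec.choose.toMonoidHom).topologicalClosure) (Subgroup.le_topologicalClosure _) cuspMeetsH).ρHat.ker → a * y = y * a) →
        a ∈ ((StableCurveTemperedData.OfSpecialFibre.towerOfSpecialFibreTower X d T Sigma SigmaHat hsub hne hprime S h36 hp TpH ((TpH.map (TemperedGraphGroupData.exists_completion_of_prop36 S.Gc h36 S.chart).choose_spec.choose.toMonoidHom).topologicalClosure) (Subgroup.le_topologicalClosure _) cuspMeetsH).Jhat i).subgroupOf (StableCurveTemperedData.ofSpecialFibre X d S h36 Sigma SigmaHat hsub hne hprime hp TpH ((TpH.map (TemperedGraphGroupData.exists_completion_of_prop36 S.Gc h36 S.chart).choose_spec.choose.toMonoidHom).topologicalClosure) (Subgroup.le_topologicalClosure _) cuspMeetsH).DeltaHat)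
    (hv : ((StableCurveTemperedData.ofSpecialFibre X d S h36 Sigma SigmaHat hsub hne hprime hp TpH ((TpH.map (TemperedGraphGroupData.exists_completion_of_prop36 S.Gc h36 S.chart).choose_spec.choose.toMonoidHom).topologicalClosure) (Subgroup.le_topologicalClosure _) cuspMeetsH).graph.HatH : Set (StableCurveTemperedData.ofSpecialFibre X d S h36 Sigma SigmaHat hsub hne hprime hp TpH ((TpH.map (TemperedGraphGroupData.exists_completion_of_prop36 S.Gc h36 S.chart).choose_spec.choose.toMonoidHom).topologicalClosure) (Subgroup.le_topologicalClosure _) cuspMeetsH).graph.Hat) ∩ Set.range (StableCurveTemperedData.ofSpecialFibre X d S h36 Sigma SigmaHat hsub hne hprime hp TpH ((TpH.map (TemperedGraphGroupData.exists_completion_of_prop36 S.Gc h36 S.chart).choose_spec.choose.toMonoidHom).topologicalClosure) (Subgroup.le_topologicalClosure _) cuspMeetsH).graph.ι = (StableCurveTemperedData.ofSpecialFibre X d S h36 Sigma SigmaHat hsub hne hprime hp TpH ((TpH.map (TemperedGraphGroupData.exists_completion_of_prop36 S.Gc h36 S.chart).choose_spec.choose.toMonoidHom).topologicalClosure) (Subgroup.le_topologicalClosure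 _) cuspMeetsH).graph.ι '' (StableCurveTemperedData.ofSpecialFibre X d S h36 Sigma SigmaHat hsub hne hprime hp TpH ((TpH.map (TemperedGraphGroupData.exists_completion_of_prop36 S.Gc h36 S.chart).choose_spec.choose.toMonoidHom).topologicalClosure) (Subgroup.le_topologicalClosure _) cuspMeetsH).graph.TpH)
    (htp : ∀ x : (StableCurveTemperedData.ofSpecialFibre X d S h36 Sigma SigmaHat hsub hne hprime hp TpH ((TpH.map (TemperedGraphGroupData.exists_completion_of_prop36 S.Gc h36 S.chart).choose_spec.choose.toMonoidHom).topologicalClosure) (Subgroup.le_topologicalClosure _) cuspMeetsH).Cusp, (StableCurveTemperedData.ofSpecialFibre X d S h36 Sigma SigmaHat hsub hne hprime hp TpH ((TpH.map (TemperedGraphGroupData.exists_completion_of_prop36 S.Gc h36 S.chart).choose_spec.choose.toMonoidHom).topologicalClosure) (Subgroup.le_topologicalClosure _) cuspMeetsH).cuspMeetsH x →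
      ∃ t : (StableCurveTemperedData.ofSpecialFibre X d S h36 Sigma SigmaHat hsub hne hprime hp TpH ((TpH.map (TemperedGraphGroupData.exists_completion_of_prop36 S.Gc h36 S.chart).choose_spec.choose.toMonoidHom).topologicalClosure) (Subgroup.le_topologicalClosure _) cuspMeetsH).graph.Tp, ((StableCurveTemperedData.ofSpecialFibre X d S h36 Sigma SigmaHat hsub hne hprime hp TpH ((TpH.map (TemperedGraphGroupData.exists_completion_of_prop36 S.Gc h36 S.chart).choose_spec.choose.toMonoidHom).topologicalClosure) (Subgroup.le_topologicalClosure _) cuspMeetsH).inertiaTp x).map (StableCurveTemperedData.ofSpecialFibre X d S h36 Sigma SigmaHat hsub hne hprime hp TpH ((TpH.map (TemperedGraphGroupData.exists_completion_of_prop36 S.Gc h36 S.chart).choose_spec.choose.toMonoidHom).topologicalClosure) (Subgroup.le_topologicalClosure _) cuspMeetsH).ρTp ≤ MulAut.conj t • (StableCurveTemperedData.ofSpecialFibre X d S h36 Sigma SigmaHat hsub hne hprime hp TpH ((TpH.map (TemperedGraphGroupData.exists_completion_of_prop36 S.Gc h36 S.chart).choose_spec.choose.toMonoidHom).topologicalClosure)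 (Subgroup.le_topologicalClosure _) cuspMeetsH).graph.TpH)
    (hhat : ∀ x : (StableCurveTemperedData.ofSpecialFibre X d S h36 Sigma SigmaHat hsub hne hprime hp TpH ((TpH.map (TemperedGraphGroupData.exists_completion_of_prop36 S.Gc h36 S.chart).choose_spec.choose.toMonoidHom).topologicalClosure) (Subgroup.le_topologicalClosure _) cuspMeetsH).Cusp,
      (∃ g : (StableCurveTemperedData.ofSpecialFibre X d S h36 Sigma SigmaHat hsub hne hprime hp TpH ((TpH.map (TemperedGraphGroupData.exists_completion_of_prop36 S.Gc h36 S.chart).choose_spec.choose.toMonoidHom).topologicalClosure) (Subgroup.le_topologicalClosure _) cuspMeetsH).graph.Hat, (((StableCurveTemperedData.ofSpecialFibre X d S h36 Sigma SigmaHat hsub hne hprime hp TpH ((TpH.map (TemperedGraphGroupData.exists_completion_of_prop36 S.Gc h36 S.chart).choose_spec.choose.toMonoidHom).topologicalClosure) (Subgroup.le_topologicalClosure _) cuspMeetsH).inertiaTp x).map (StableCurveTemperedData.ofSpecialFibre X d S h36 Sigma SigmaHat hsub hne hprime hp TpH ((TpH.map (TemperedGraphGroupData.exists_completion_of_prop36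 S.Gc h36 S.chart).choose_spec.choose.toMonoidHom).topologicalClosure) (Subgroup.le_topologicalClosure _) cuspMeetsH).ρTp).map (StableCurveTemperedData.ofSpecialFibre X d S h36 Sigma SigmaHat hsub hne hprime hp TpH ((TpH.map (TemperedGraphGroupData.exists_completion_of_prop36 S.Gc h36 S.chart).choose_spec.choose.toMonoidHom).topologicalClosure) (Subgroup.le_topologicalClosure _) cuspMeetsH).graph.ι ≤ MulAut.conj g • (StableCurveTemperedData.ofSpecialFibre X d S h36 Sigma SigmaHat hsub hne hprime hp TpH ((TpH.map (TemperedGraphGroupData.exists_completion_of_prop36 S.Gc h36 S.chart).choose_spec.choose.toMonoidHom).topologicalClosure) (Subgroup.le_topologicalClosure _) cuspMeetsH).graph.HatH) → (StableCurveTemperedData.ofSpecialFibre X d S h36 Sigma SigmaHat hsub hne hprime hp TpH ((TpH.map (TemperedGraphGroupData.exists_completion_of_prop36 S.Gc h36 S.chart).choose_spec.choose.toMonoidHom).topologicalClosure) (Subgroup.le_topologicalClosure _) cuspMeetsH).cuspMeetsH x)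
    -- Prop 2.4 (i) inputs (p.50 l.25 – p.51 l.10): [Config] Rmk 1.2.2
    (hstf : (StableCurveTemperedData.ofSpecialFibre X d S h36 Sigma SigmaHat hsub hne hprime hp TpH ((TpH.map (TemperedGraphGroupData.exists_completion_of_prop36 S.Gc h36 S.chart).choose_spec.choose.toMonoidHom).topologicalClosure) (Subgroup.le_topologicalClosure _) cuspMeetsH).StronglyTorsionFreeSigma)
    -- DATA: a verticial family in every level chart ([SemiAnbd] Thm 3.7 (i); exists by `exists_verticialFamily_level`)
    (Λv : ∀ i, (T.Gc i).graph.Vertex → Subgroup (T.chart i).G)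
    (hΛv : ∀ i v, Λv i v ∈ verticialSubgroups (T.chart i) v)
    -- DATA: level node data (nodes of the level graphs with their end-points and branch conjugators)
    (E : ℕ → Type) (src tgt : ∀ i, E i → (T.Gc i).graph.Vertex) (c₁ c₂ : ∀ i, E i → (T.chart i).G)
    -- (A3) = [AbsTopII] Prop 1.3 (iv) / [NodNon] Lem 1.9 (ii), level form (p.45 l.35–39 at each `𝔾_{J_i}`)
    (hA3 : ∀ i (v w : (T.Gc i).graph.Vertex)
      (g h : (StableCurveTemperedData.OfSpecialFibre.levelGraph X T Sigma SigmaHat hsub hne hprime i).Hat),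
      MulAut.conj g • (Λv i v).map (StableCurveTemperedData.OfSpecialFibre.levelGraph X T Sigma SigmaHat hsub hne hprime i).ι ⊓
          MulAut.conj h • (Λv i w).map (StableCurveTemperedData.OfSpecialFibre.levelGraph X T Sigma SigmaHat hsub hne hprime i).ι ≠ ⊥ →
        (v = w ∧ g⁻¹ * h ∈ (Λv i v).map (StableCurveTemperedData.OfSpecialFibre.levelGraph X T Sigma SigmaHat hsub hne hprime i).ι) ∨
        ∃ (e : E i) (k : (StableCurveTemperedData.OfSpecialFibre.levelGraph X T Sigma SigmaHat hsub hne hprime i).Hat),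
          ∃ p ∈ (Λv i (src i e)).map (StableCurveTemperedData.OfSpecialFibre.levelGraph X T Sigma SigmaHat hsub hne hprime i).ι,
          ∃ q ∈ (Λv i (tgt i e)).map (StableCurveTemperedData.OfSpecialFibre.levelGraph X T Sigma SigmaHat hsub hne hprime i).ι,
            (src i e = v ∧ tgt i e = w ∧
                g = k * (StableCurveTemperedData.OfSpecialFibre.levelGraph X T Sigma SigmaHat hsub hne hprime i).ι (c₁ i e) * p ∧
                h = k * (StableCurveTemperedData.OfSpecialFibre.levelGraph X T Sigma SigmaHat hsub hne hprime i).ι (c₂ i e) * q) ∨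
            (src i e = w ∧ tgt i e = v ∧
                h = k * (StableCurveTemperedData.OfSpecialFibre.levelGraph X T Sigma SigmaHat hsub hne hprime i).ι (c₁ i e) * p ∧
                g = k * (StableCurveTemperedData.OfSpecialFibre.levelGraph X T Sigma SigmaHat hsub hne hprime i).ι (c₂ i e) * q))
    -- the `p ∉ Σ` specialisation half and the inverse-limit detection of the level data (Prop 2.4 (i) proof, p.50 l.40 – p.51 l.10)
    (hspec : (StableCurveTemperedData.OfSpecialFibre.towerOfSpecialFibreTower X d T Sigma SigmaHat hsub hne hprime S h36 hp TpH ((TpH.map (TemperedGraphGroupData.exists_completion_of_prop36 S.Gc h36 S.chart).choose_spec.choose.toMonoidHom).topologicalClosure) (Subgroup.le_topologicalClosure _) cuspMeetsH).SpecializationAb)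
    (hadm : ∀ U ∈ 𝓝 (1 : ↥X.DeltaTemp), ∃ j, ((T.admKer j : Subgroup ↥X.DeltaTemp) : Set ↥X.DeltaTemp) ⊆ U)
    (hLev : (StableCurveTemperedData.OfSpecialFibre.qTowerOfSpecialFibreTower X T d S h36 Sigma SigmaHat hsub hne hprime hp TpH ((TpH.map (TemperedGraphGroupData.exists_completion_of_prop36 S.Gc h36 S.chart).choose_spec.choose.toMonoidHom).topologicalClosure) (Subgroup.le_topologicalClosure _) cuspMeetsH P.admKer_normal_pi).LevelObservation) :
    (StableCurveTemperedData.ofSpecialFibre X d S h36 Sigma SigmaHat hsub hne hprime hp TpH ((TpH.map (TemperedGraphGroupData.exists_completion_of_prop36 S.Gc h36 S.chart).choose_spec.choose.toMonoidHom).topologicalClosure) (Subgroup.le_topologicalClosure _) cuspMeetsH).Cor23i ∧ (StableCurveTemperedData.ofSpecialFibre X d S h36 Sigma SigmaHat hsub hne hprime hp TpH ((TpH.map (TemperedGraphGroupData.exists_completion_of_prop36 S.Gc h36 S.chart).choose_spec.choose.toMonoidHom).topologicalClosure) (Subgroup.le_topologicalClosure _) cuspMeetsH).Cor23ii ∧ (StableCurveTemperedData.ofSpecialFibre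 X d S h36 Sigma SigmaHat hsub hne hprime hp TpH ((TpH.map (TemperedGraphGroupData.exists_completion_of_prop36 S.Gc h36 S.chart).choose_spec.choose.toMonoidHom).topologicalClosure) (Subgroup.le_topologicalClosure _) cuspMeetsH).Cor23iii ∧ (StableCurveTemperedData.ofSpecialFibre X d S h36 Sigma SigmaHat hsub hne hprime hp TpH ((TpH.map (TemperedGraphGroupData.exists_completion_of_prop36 S.Gc h36 S.chart).choose_spec.choose.toMonoidHom).topologicalClosure) (Subgroup.le_topologicalClosure _) cuspMeetsH).Cor23iv ∧ (StableCurveTemperedData.ofSpecialFibre X d S h36 Sigma SigmaHat hsub hne hprime hp TpH ((TpH.map (TemperedGraphGroupData.exists_completion_of_prop36 S.Gc h36 S.chart).choose_spec.choose.toMonoidHom).topologicalClosure) (Subgroup.le_topologicalClosure _) cuspMeetsH).Cor23v ∧ (StableCurveTemperedData.ofSpecialFibre X d S h36 Sigma SigmaHat hsub hne hprime hp TpH ((TpH.map (TemperedGraphGroupData.exists_completion_of_prop36 S.Gc h36 S.chart).choose_spec.choose.toMonoidHom).topologicalClosure) (Subgroup.le_topologicalClosure _) cuspMeetsH).Cor23vi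 ∧
    ((StableCurveTemperedData.ofSpecialFibre X d S h36 Sigma SigmaHat hsub hne hprime hp TpH ((TpH.map (TemperedGraphGroupData.exists_completion_of_prop36 S.Gc h36 S.chart).choose_spec.choose.toMonoidHom).topologicalClosure) (Subgroup.le_topologicalClosure _) cuspMeetsH).Cor25Decomposition ∧ (StableCurveTemperedData.ofSpecialFibre X d S h36 Sigma SigmaHat hsub hne hprime hp TpH ((TpH.map (TemperedGraphGroupData.exists_completion_of_prop36 S.Gc h36 S.chart).choose_spec.choose.toMonoidHom).topologicalClosure) (Subgroup.le_topologicalClosure _) cuspMeetsH).Cor25Inertia) ∧ (StableCurveTemperedData.ofSpecialFibre X d S h36 Sigma SigmaHat hsub hne hprime hp TpH ((TpH.map (TemperedGraphGroupData.exists_completion_of_prop36 S.Gc h36 S.chart).choose_spec.choose.toMonoidHom).topologicalClosure) (Subgroup.le_topologicalClosure _) cuspMeetsH).Prop24iii := by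
  haveI : Nonempty X.Pt := ⟨x.1⟩
  haveI : Nonempty {x : X.Pt // X.IsCusp x} := ⟨x⟩
  have h24 := StableCurveTemperedData.OfSpecialFibre.prop24i_prop24ii_ofPiData_of_admKer_nhds_one X d T Sigma SigmaHat hsub hne hprime
    S h36 hp TpH
    ((TpH.map (TemperedGraphGroupData.exists_completion_of_prop36 S.Gc h36 S.chart).choose_spec.choose.toMonoidHom).topologicalClosure)
    (Subgroup.le_topologicalClosure _) cuspMeetsH P hstf Λv hΛv E src tgt c₁ c₂ hA3 hspec hadm hLev
  exact layer5_held_sec2_v6_piData X d S h36 Sigma SigmaHat hsub hne hprime hp TpH cuspMeetsH x T P h22 hHstab hA hB hv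
    htp hhat h24.1 h24.2

end Sec2V8

/-- **THE LAYER-5 CERTIFICATE v8 — SINGLE TOP OF RECORD**: the conjunction, BY NAME via `StatementOf`, of the v7 top `layer5_of_S_v7`
(`Conditional/Layer5OfSV07.lean`, p445926; through it v6 … v0 and the companion) and this module's `layer5_held_ex51v_v8_L27_halfGenuine` (E51/L27 with an
independent étale interface, brackets), `layer5_held_ex51v_v8_L27x_genuine` (NEW COVERAGE: the ∞κ× display), `layer5_held_sec2_v8_prop24_piData_complete`
(§2 (β′), `hINV` discharged).  CENSUS v8: most-reduced CONE 34 (+2 record-laws in `P`) · FACT 0 · side 15 · NV 3 (headline unchanged; coverage +1; (β′) 12).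
S-FREE.  Nothing here asserts that abc is proved or refuted or takes a side on [IUTchIII] Cor. 3.12; a binder is an assumption label; typed ≠ discharged;
indexed ≠ endorsed. -/
theorem layer5_of_S_v8 :
    Summit.ABC.IUTFork.DAG.PartL5a.StatementOf @layer5_of_S_v7 ∧
    Summit.ABC.IUTFork.DAG.PartL5a.StatementOf @layer5_held_ex51v_v8_L27_halfGenuine ∧
    Summit.ABC.IUTFork.DAG.PartL5a.StatementOf @layer5_held_ex51v_v8_L27x_genuine ∧
    Summit.ABC.IUTFork.DAG.PartL5a.StatementOf @layer5_held_sec2_v8_prop24_piData_complete :=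
  ⟨@layer5_of_S_v7, @layer5_held_ex51v_v8_L27_halfGenuine, @layer5_held_ex51v_v8_L27x_genuine, @layer5_held_sec2_v8_prop24_piData_complete⟩

end Summit.ABC.IUTFork.Conditional

/-! ### Build-lane export guard (ops-buildfix bf1-g30, 2026-08-28; G11b-3 recipe v2 as in `GelbartRogawski1991/UnitaryDualPairSeesawCharacter`):
the theorems of this file carry very large dependent telescopes; at `.olean` export Lean 4.32's library-suggestion indexers fold over
every local theorem statement and do not finish within the build lane's one-hour clock (measured on a farm node: `lean -o` > 1 500 s, plain
elaboration ≈ 20 s). ONE file-final `local` `[implicit_reducible]` keeps them out of that premise index (inert for Meta and the kernel on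
theorems; no definition is tagged; statements and proofs unchanged). -/
set_option allowUnsafeReducibility true in
attribute [local implicit_reducible]
  _root_.Summit.ABC.IUTFork.Conditional.layer5_held_ex51v_v8_L27_halfGenuine
  _root_.Summit.ABC.IUTFork.Conditional.layer5_held_ex51v_v8_L27x_genuine
  _root_.Summit.ABC.IUTFork.Conditional.layer5_held_sec2_v8_prop24_piData_complete
  _root_.Summit.ABC.IUTFork.Conditional.layer5_of_S_v8
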